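import Summits.BirchSwinnertonDyer.BirchSwinnertonDyer.Theorems.GenusKolyvaginAtTwoK4PosTwinBsdRoadRealWitness
import Summits.BirchSwinnertonDyer.BirchSwinnertonDyer.Theorems.GenusKolyvaginAtTwoOffCutResidualAtTwoRLw2PhantomExclusionRatSelmer
import Summits.BirchSwinnertonDyer.BirchSwinnertonDyer.Theorems.GenusKolyvaginAtTwoGenusPrimitiveSupplyAtTwoArchimedeanRelaxedSwitch
import HarnessLib

/-!
# Route `GenusKolyvaginAtTwo`, K₄⁺ kernel `K4Pos` (stmt-BirchSwinnertonDyer-31469), LINE 33 «twin_bsd_road» STUB F4′ —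
# `(NPh_K)` HOLDS ON THE WHOLE K₄⁺ CELL, ON AND OFF THE CUT, AT EVERY `2`-SPLIT HEEGNER FRAME

Width seat `bsd-line-gk2-p4` g32 (cell `bsd-f1-sign2`), WIDTH-5 attach on route `GenusKolyvaginAtTwo` rev 59; director rulings (642)(2)/(644)(b)
(the one GK2 width seat on F4′ = `(NPh_K)` off the cut).  `--supports stmt-BirchSwinnertonDyer-31469 --as helper`.  THEOREMS ONLY (no definition,
no named fact, no `sorry`); standard axioms.  **BSD is NOT proved by this file; `K4Pos` is NOT proved; no item is closed by it.**

WHAT.  The engine hypothesis `(NPh_K)` — «every class of `H¹(K, E[2^M])` dying on `Γ_{K(E[2^M])}` (a PHANTOM, inflated from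
`H¹(Gal(K(E[2^M])/K), E[2^M]) ≅ ℤ/2`) that is locally a Kummer class is `0`» — the hypothesis of the LEAD's master halving descent B2Q♭
(`PlusDescent.exists_transpositionDeep_primitive_of_two_pow_pred_smul_ne_zero_of_nonPhantom`), so far discharged ONLY at an odd multiplicative (Tate)
prime (`NonPhantomPow.nonPhantomAtTwo_of_hasMultiplicativeReductionAt`; LINE 26 `…Lw2PhantomExclusionCut`), and typed by the pen as LINE 33's only
shortest-path stub F4′ `stub_offCutNonPhantom` (v1.2) — **is a THEOREM on the K₄⁺ cell** (`Δ_E > 0`, `ρ_{E,2^n}` onto, the K₄⁺ REAL clause «some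
`2`-Selmer class of `E` is non-trivial at `∞`») **at every `2`-split Heegner frame** (`K` imaginary quadratic, `d_K` odd, the two B₂ non-squares,
Heegner for `N_E`, `2` split — exactly the frames of `K4Pos`), with NO hypothesis on the odd bad primes (on OR off the cut), no `Ш`, no L-value:
* `exists_finite_place_not_mem_selmerLocalKer` — `Δ_E > 0`, `ρ̄_{E,2}`, `ρ̄_{E,4}` onto, and some `c ∈ Sel₂(E)` with `res_∞ c ≠ 0`: every NON-ZERO
  `x ∈ H¹(ℚ, E[2])` dying on `Γ_{ℚ(E[4])}` (the Lawson–Wuthrich class `ξ`) FAILS the Kummer condition at some FINITE prime.  Proof: were `ξ` Kummer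
  at every finite prime it would lie in `Sel₂^{rel ∞}(E)`, which the real clause collapses onto `Sel₂(E)` (Poitou–Tate with real places, Mazur–Rubin
  Lemma 3.2 — `GenusKolyArch.selmerGroupRelaxedAtInfinityAtTwo_eq_selmerGroup_of_exists_localization_ne_zero`, kernel theorem), so `ξ` would be
  Kummer at `∞` — but for `Δ_E > 0` it never is (`…RealWitness.not_mem_selmerLocalKer_infinitePlace_of_forall_torsionFixing_four`, this seat).
* ★ `nonPhantom_pow_of_realClause` — hence, by this lineage's `E`-intrinsic criterion (`Lw2PhantomExclusion.nonPhantom_pow_iff_exists_finite_place_rat`,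
  g31), **`(NPh_M)(E, K)` for every `M ≥ 1`** at every `2`-split Heegner frame (form «Kummer at the places over `2N` ⟹ `0`»).
* ★★ `offCutNonPhantom_of_twoSplit` — the conclusion of LINE 33's F4′ `stub_offCutNonPhantom` VERBATIM (all-finite-places form, the `hNPh` of
  `kFour_shape_offCut_of_nonPhantom` / B2Q♭), on F4′'s binders VERBATIM plus ONE frame binder `h2K : #{𝔭 ∣ 2} = 2` (which `K4Pos` and the
  compositions `K4Pos_of_wall_U2_nonPhantom` / `offCut_of_wall_U2_of_nonPhantom` carry); the habitat binders `hcm`, `hr0`, `hT`, `hoff`, `h3` and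
  `#Sel₂ = 4` are NOT used — the K₄⁺ real clause alone drives it.
READING (census, for the pen / LEAD / director; no item is closed and (644)(a) stands — the wall roads are inter-route census only): with F4′ a theorem on
every `2`-split frame, LINE 33's `K4Pos_of_wall_U2_nonPhantom` has NO open stub left: `K4Pos ⟸ WALL row 1 + U₂ + Q2 + PRINT` is kernel-certified on AND
off the cut, i.e. **K₄⁺ has no private content beyond {WALL row 1, U₂, Q2, PRINT}**; and every `(NPh)`-fed engine (LINE 18 B2Q♭, LINE 24/26) runs
unconditionally on the K₄⁺ cell.  The LW16 §7.1/§8 phantom falsifier CANNOT bite on `Δ > 0`: the real place is the witness, and the K₄⁺ real clause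
A9.1 is precisely the parity switch that forwards it to a finite prime.  On K₄⁻ (`Δ < 0`) the real place is silent (`Sel₂^{rel ∞} = Sel₂` for free) and
`(NPh) ⟺ ξ ∉ Sel₂(E/ℚ)` (g31 `nonPhantom_pow_iff_forall_notMem_selmerGroup_rat`) stays a per-curve `2`-descent datum.  BSD is NOT proved by any of this.

References: [LawsonWuthrich2016] Lemma 3, Thm. 1, §7.1, §8; [MazurRubin2010] Def. 3.1, Lemma 3.2; [Kramer1981] §2 Prop. 6; [GrossLMS1991] §6, §9;
[MilneADT2006] I Thm. 4.10, Rem. 3.7.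
-/

set_option autoImplicit false
set_option linter.dupNamespace false -- `Summit.<P>.<Sub>` repeats `BirchSwinnertonDyer` (D-0017)

noncomputable section

open scoped Classical NumberField

namespace Summit.BirchSwinnertonDyer.BirchSwinnertonDyer.Theorems.GenusExact.Lw2PhantomExclusion.RealWitness

open WeierstrassCurve Field NumberField IsDedekindDomain
open Literature.NumberTheory.EllipticCurves Literature.NumberTheory.GaloisRepresentations
open Summit.BirchSwinnertonDyer.Rank1Residual.F1Sign2 (selmerGroupRelaxedAtInfinityAtTwo mem_selmerGroupRelaxedAtInfinityAtTwo_iff)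

variable (W : WeierstrassCurve ℚ) [W.IsElliptic]

/-! ## §3 A finite witness prime exists for every curve with the K₄⁺ real clause -/

/-- ★ **`Δ_E > 0` + a real-visible `2`-Selmer class ⟹ the Lawson–Wuthrich class fails the Kummer condition at a FINITE prime.**  `E/ℚ` elliptic,
`Δ_E > 0`, `ρ̄_{E,2}`, `ρ̄_{E,4}` surjective, and some `c ∈ Sel₂(E)` with `res_∞ c ≠ 0` (the K₄⁺ real clause).  Then every non-zero `x ∈ H¹(ℚ, E[2])`
dying on `Γ_{ℚ(E[4])}` is outside `selmerLocalKer ℚ_v 2` for some finite `v` (necessarily `v ∣ 2N`).  Proof: otherwise `x ∈ Sel₂^{rel ∞}(E) = Sel₂(E)`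
(Mazur–Rubin Lemma 3.2 with the real clause, kernel theorem `GenusKolyArch.selmerGroupRelaxedAtInfinityAtTwo_eq_selmerGroup_of_exists_localization_ne_zero`),
so `x` is Kummer at `∞`, contradicting `not_mem_selmerLocalKer_infinitePlace_of_forall_torsionFixing_four`.
[cite: MazurRubin2010, Lemma 3.2] [cite: LawsonWuthrich2016, §7.1] [cite: Kramer1981, §2 Prop. 6 (p. 127)] -/
theorem exists_finite_place_not_mem_selmerLocalKer (hΔ : 0 < W.Δ) (hs2 : W.HasSurjectiveModNGaloisRep (2 : ℤ))
    (hs4 : W.HasSurjectiveModNGaloisRep (4 : ℤ)) (w : InfinitePlace ℚ)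
    (hreal : ∃ c ∈ W.selmerGroup ((2 : ℕ) : ℤ),
      galoisCohomology.localization (W.torsionGaloisModule ((2 : ℕ) : ℤ)) (Sum.inl w) 1 c ≠ 0)
    {x : galH1Torsion W (2 : ℤ)} (hx0 : x ≠ 0) (hph : ∀ ρ ∈ torsionFixing W (4 : ℤ), h1Eval W (2 : ℤ) x ρ = 0) :
    ∃ v : HeightOneSpectrum (𝓞 ℚ), x ∉ selmerLocalKer W (v.adicCompletion ℚ) (2 : ℤ) := by
  by_contra hall
  push Not at hall
  have hrel : x ∈ selmerGroupRelaxedAtInfinityAtTwo W := (mem_selmerGroupRelaxedAtInfinityAtTwo_iff W x).mpr hall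
  rw [GenusKolyArch.selmerGroupRelaxedAtInfinityAtTwo_eq_selmerGroup_of_exists_localization_ne_zero W hΔ w hreal] at hrel
  exact not_mem_selmerLocalKer_infinitePlace_of_forall_torsionFixing_four W hΔ hs2 hs4 w hx0 hph
    (((WeierstrassCurve.mem_selmerGroup_iff W _ x).1 hrel).2 w)

/-! ## §4 ★ `(NPh_K)` on the K₄⁺ cell at every `2`-split Heegner frame -/

/-- ★ **`(NPh_M)(E, K)` FOR EVERY `M ≥ 1` — `Δ_E > 0`, the K₄⁺ real clause, any `2`-split Heegner frame.**  `E/ℚ` elliptic with `Δ_E > 0`,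
`ρ_{E,2^n}` onto for all `n ≥ 1`, some `c ∈ Sel₂(E)` non-trivial at `∞`; `K` imaginary quadratic with `d_K` odd, `d_K·(−|Δ|)` and `d_K·(−2|Δ|)`
non-squares, Heegner for `N_E` and `2` split in `K`.  Then for every `M ≥ 1`, every `z ∈ H¹(K, E[2^M])` with `[z, ρ] = 0` for all `ρ ∈ Γ_{K(E[2^M])}`
that is Kummer at every place `w ∋ 2N_E` is `0`.  (`nonPhantom_pow_iff_exists_finite_place_rat` + §3.)  No hypothesis on the odd bad primes: ON and
OFF the cut.  BSD is NOT proved by this. [cite: LawsonWuthrich2016, §3, §7.1, §8] [cite: GrossLMS1991, §9 Prop. 9.1] [cite: MazurRubin2010, Lemma 3.2] -/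
theorem nonPhantom_pow_of_realClause {K : Type} [Field K] [NumberField K] (hΔ : 0 < W.Δ)
    (hρ : ∀ n : ℕ, 0 < n → W.HasSurjectiveModNGaloisRep ((2 : ℤ) ^ n))
    (hreal : ∃ c ∈ W.selmerGroup ((2 : ℕ) : ℤ),
      galoisCohomology.localization (W.torsionGaloisModule ((2 : ℕ) : ℤ)) (Sum.inl Rat.infinitePlace) 1 c ≠ 0)
    (hK : IsImaginaryQuadratic K) (hodd : Odd (NumberField.discr K)) (hnsq₁ : ¬ IsSquare ((NumberField.discr K : ℚ) * -|W.Δ|))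
    (hnsq₂ : ¬ IsSquare ((NumberField.discr K : ℚ) * (-(2 * |W.Δ|)))) (hN : W.conductorNorm ℤ ≠ 0)
    (hH : SatisfiesHeegnerHypothesis (W.conductorNorm ℤ) K) (h2 : ((Ideal.span {(2 : ℤ)}).primesOver (𝓞 K)).ncard = 2) :
    ∀ (Mlev : ℕ), 1 ≤ Mlev → ∀ z : galH1Torsion (W.baseChange K) ((2 ^ Mlev : ℕ) : ℤ),
      (∀ ρ ∈ torsionFixing (W.baseChange K) ((2 ^ Mlev : ℕ) : ℤ), h1Eval (W.baseChange K) ((2 ^ Mlev : ℕ) : ℤ) z ρ = 0) →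
      (∀ w : HeightOneSpectrum (𝓞 K), ((2 * W.conductorNorm ℤ : ℕ) : 𝓞 K) ∈ w.asIdeal →
        z ∈ selmerLocalKer (W.baseChange K) (w.adicCompletion K) ((2 ^ Mlev : ℕ) : ℤ)) → z = 0 := by
  have hs2 : W.HasSurjectiveModNGaloisRep (2 : ℤ) := by simpa using hρ 1 one_pos
  have hs4 : W.HasSurjectiveModNGaloisRep (4 : ℤ) := by have h := hρ 2 two_pos; norm_num at h; exact h
  exact (nonPhantom_pow_iff_exists_finite_place_rat W hρ hK hodd hnsq₁ hnsq₂ hN hH h2).mpr fun x hx0 hx ↦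
    exists_finite_place_not_mem_selmerLocalKer W hΔ hs2 hs4 Rat.infinitePlace hreal hx0 hx

/-- ★★ **LINE 33's F4′ `stub_offCutNonPhantom` on the crux's own frames — its conclusion VERBATIM on its binders VERBATIM plus `h2K`.**  For `E = W`
on the (off-cut) K₄⁺ cell and an admissible `K` in which `2` SPLITS (the frame of `K4Pos`: `K = ℚ(√−ℓ₀)`, `2` split): for every `L ≥ 1`, a class
`z ∈ H¹(K, E[2^L])` dying on `Γ_{K(E[2^L])}` that is locally a Kummer class at EVERY finite place of `K` is ZERO.  The habitat binders `hcm`, `hr0`,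
`hT`, `hoff`, `h3` and the count `#Sel₂(E) = 4` are idle (kept for the by-name plug; `_`-prefixed): the K₄⁺ REAL clause of `h4` alone drives it
(`nonPhantom_pow_of_realClause`).  So the stub holds on AND off the cut; the pen's `K4Pos_of_wall_U2_nonPhantom hOrd hMult hSS hAdd hTw hQ2 hGZ hGZK hL hMi`
becomes sorry-free with `stub_offCutNonPhantom … hsq1 hsq2 := offCutNonPhantom_of_twoSplit … hsq1 hsq2 h2K` (inter-route census only, (644)(a)).
BSD is NOT proved by this; `K4Pos` is NOT proved. [cite: LawsonWuthrich2016, §7.1, §8] [cite: MazurRubin2010, Lemma 3.2] [cite: McCallumLMS1991, §5 Thm. 5.4] -/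
theorem offCutNonPhantom_of_twoSplit
    (W : WeierstrassCurve ℚ) [W.IsElliptic] [W.IsGloballyMinimal] [NeZero (W.conductorNorm ℤ)]
    (_hcm : ¬ W.HasCM) (_hr0 : W.analyticRank = 0) (hρ : ∀ n : ℕ, 0 < n → W.HasSurjectiveModNGaloisRep ((2 : ℤ) ^ n))
    (_hT : Odd W.tamagawaProduct) (hpos : 0 < W.Δ)
    (h4 : Nat.card (W.selmerGroup 2) = 4 ∧ ∃ c ∈ (W.kummerSelmerStructure ((2 : ℕ) : ℤ)).selmerGroup,
      galoisCohomology.localization (W.torsionGaloisModule ((2 : ℕ) : ℤ)) (Sum.inl Rat.infinitePlace) 1 c ≠ 0)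
    (_hoff : ¬ ∃ v : HeightOneSpectrum (𝓞 ℚ), ((2 : ℕ) : 𝓞 ℚ) ∉ v.asIdeal ∧ ((W.conductorNorm ℤ : ℕ) : 𝓞 ℚ) ∈ v.asIdeal ∧
      W.HasMultiplicativeReductionAt v)
    (K : Type) [Field K] [NumberField K] (hIQ : IsImaginaryQuadratic K) (hodd : Odd (NumberField.discr K))
    (_h3 : NumberField.discr K ≠ -3) (hHe : SatisfiesHeegnerHypothesis (W.conductorNorm ℤ) K)
    (hsq1 : ¬ IsSquare ((NumberField.discr K : ℚ) * -|W.Δ|)) (hsq2 : ¬ IsSquare ((NumberField.discr K : ℚ) * (-(2 * |W.Δ|))))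
    (h2K : ((Ideal.span {(2 : ℤ)}).primesOver (𝓞 K)).ncard = 2) :
    ∀ (L : ℕ), 1 ≤ L → ∀ z : galH1Torsion (W.baseChange K) ((2 ^ L : ℕ) : ℤ),
      (∀ ρ' ∈ torsionFixing (W.baseChange K) ((2 ^ L : ℕ) : ℤ), h1Eval (W.baseChange K) ((2 ^ L : ℕ) : ℤ) z ρ' = 0) →
      (∀ w : HeightOneSpectrum (𝓞 K), z ∈ selmerLocalKer (W.baseChange K) (w.adicCompletion K) ((2 ^ L : ℕ) : ℤ)) → z = 0 := by
  intro L hL z hz hloc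
  have hreal : ∃ c ∈ W.selmerGroup ((2 : ℕ) : ℤ),
      galoisCohomology.localization (W.torsionGaloisModule ((2 : ℕ) : ℤ)) (Sum.inl Rat.infinitePlace) 1 c ≠ 0 := by
    obtain ⟨c, hc, hne⟩ := h4.2
    exact ⟨c, (SetLike.ext_iff.mp (W.selmerGroup_eq_selmerGroup_kummerSelmerStructure _) c).mpr hc, hne⟩
  exact nonPhantom_pow_of_realClause W hpos hρ hreal hIQ hodd hsq1 hsq2 (NeZero.ne _) hHe h2K L hL z hz (fun w _ ↦ hloc w)

/-- **The same with the CUT in place of `hoff`** (on-cut K₄⁺ frames; the binder list of LINE 33's `onCut_of_wall_U2` / `stub_frameAttainment` up to the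
frame): `(NPh_K)` there was so far obtained from the Tate prime (`NonPhantomPow.nonPhantomAtTwo_of_hasMultiplicativeReductionAt`); here it comes from the
real place, uniformly with the off-cut case.  BSD is NOT proved by this. [cite: LawsonWuthrich2016, §7.1] [cite: MazurRubin2010, Lemma 3.2] -/
theorem nonPhantom_of_kFourPos_twoSplit
    (W : WeierstrassCurve ℚ) [W.IsElliptic] [NeZero (W.conductorNorm ℤ)]
    (hρ : ∀ n : ℕ, 0 < n → W.HasSurjectiveModNGaloisRep ((2 : ℤ) ^ n)) (hpos : 0 < W.Δ)
    (h4 : Nat.card (W.selmerGroup 2) = 4 ∧ ∃ c ∈ (W.kummerSelmerStructure ((2 : ℕ) : ℤ)).selmerGroup,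
      galoisCohomology.localization (W.torsionGaloisModule ((2 : ℕ) : ℤ)) (Sum.inl Rat.infinitePlace) 1 c ≠ 0)
    (K : Type) [Field K] [NumberField K] (hIQ : IsImaginaryQuadratic K) (hodd : Odd (NumberField.discr K))
    (hHe : SatisfiesHeegnerHypothesis (W.conductorNorm ℤ) K)
    (hsq1 : ¬ IsSquare ((NumberField.discr K : ℚ) * -|W.Δ|)) (hsq2 : ¬ IsSquare ((NumberField.discr K : ℚ) * (-(2 * |W.Δ|))))
    (h2K : ((Ideal.span {(2 : ℤ)}).primesOver (𝓞 K)).ncard = 2) :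
    ∀ (L : ℕ), 1 ≤ L → ∀ z : galH1Torsion (W.baseChange K) ((2 ^ L : ℕ) : ℤ),
      (∀ ρ' ∈ torsionFixing (W.baseChange K) ((2 ^ L : ℕ) : ℤ), h1Eval (W.baseChange K) ((2 ^ L : ℕ) : ℤ) z ρ' = 0) →
      (∀ w : HeightOneSpectrum (𝓞 K), z ∈ selmerLocalKer (W.baseChange K) (w.adicCompletion K) ((2 ^ L : ℕ) : ℤ)) → z = 0 := by
  intro L hL z hz hloc
  have hreal : ∃ c ∈ W.selmerGroup ((2 : ℕ) : ℤ),
      galoisCohomology.localization (W.torsionGaloisModule ((2 : ℕ) : ℤ)) (Sum.inl Rat.infinitePlace) 1 c ≠ 0 := by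
    obtain ⟨c, hc, hne⟩ := h4.2
    exact ⟨c, (SetLike.ext_iff.mp (W.selmerGroup_eq_selmerGroup_kummerSelmerStructure _) c).mpr hc, hne⟩
  exact nonPhantom_pow_of_realClause W hpos hρ hreal hIQ hodd hsq1 hsq2 (NeZero.ne _) hHe h2K L hL z hz (fun w _ ↦ hloc w)

end Summit.BirchSwinnertonDyer.BirchSwinnertonDyer.Theorems.GenusExact.Lw2PhantomExclusion.RealWitness

end
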